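import Summits.BirchSwinnertonDyer.BirchSwinnertonDyer.Theorems.GoldfeldAllTwistsTwoConverseTwinAdditiveTwoPrimesTwistSelmerThreeModEightPlusPFive
import Summits.BirchSwinnertonDyer.BirchSwinnertonDyer.Theorems.GoldfeldAllTwistsTwoConverseTwinAdditiveTwoPrimesTwistSelmerDualThreeModEightPlusPFiveAlpha
import Summits.BirchSwinnertonDyer.BirchSwinnertonDyer.Theorems.GoldfeldAllTwistsTwoConverseTwinAdditiveTwoPrimesTwistDescent
import HarnessLib

set_option linter.dupNamespace false -- namespace `…BirchSwinnertonDyer.BirchSwinnertonDyer…` is the cell's (D-0017 nested layout)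
set_option autoImplicit false

/-!
# OBJECT A3⁺ tranche F-I, file F2: the SHARP complete `2`-descent of `W = 49a1^{(−2qp)}` on a35+ (`q ≡ 3 (8)`, `(q/7) = −1`; `p ≡ 5 (8)`, `(−7/p) = 1`,
# TYPE α; `(p/q) = +1`) — `rank ≤ 1`, and `rank = 1 ⇒ Ш(W)[2] = 0 ⇒ Ш(W)[2^∞] = 0 ∧ corank_{ℤ₂} Sel_{2^∞}(W) = 1` — FACT-FREE, NO Cassels–Tate

Cell `bsd-goldfeld`, seat `bsd-goldfeld-s1p-c3x` (gen 17); planner ORDER (cdvi) «A3⁺-F» tranche F-I (the descent input of the formula axis on a35+).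
TWIN of B5⁺'s Fβ⁺-4b `…TwinAdditiveTwoPrimesTwistDescentSharpThreeModEightPlusPFive` (statement letter-identical except the type binder, now `hα : ¬ ∃ x, x⁴ = −7`)
with the a35+ Selmer bounds: `#S(−42qp, 448q²p²) ≤ 2` (Fβ⁺-2 `card_twoIsogenySelmerGroup_twoPrimesTwist_le_two_threeModEightPlusPFive`, TYPE-FREE, by name)
and `#S′ = #S(84qp, −28q²p²) ≤ 4` (F1 `card_twoIsogenySelmerGroup'_twoPrimesTwist_le_four_threeModEightPlusPFiveAlpha`, type α: survivors `1, −7, −qp, 7qp`)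
⇒ `#S·#S′ ≤ 8`. `--supports stmt-BirchSwinnertonDyer-19140` as a HELPER. Theses-free; theorems only; no definition, no fact binder, no `sorry`. FRONTIER-grade:
a twist-density-ZERO sub-family; never distance-to-summit. HONEST FRAMING: no `BSD(W,2)` is proved here; items 19140 / 20044 unchanged; BSD is not proved.

References: [SilvermanAEC2009] Thm. X.4.2(a), Prop. X.4.9, Thm. III.6.2(a).
-/

noncomputable section

open scoped Classical

open WeierstrassCurve Literature.NumberTheory.EllipticCurves

namespace Summit.BirchSwinnertonDyer.BirchSwinnertonDyer.Theorems.GoldfeldGoodTwists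

section DescentSharpThreeModEightPlusPFiveAlpha
variable {q p : ℕ} [Fact q.Prime] [Fact p.Prime]

/-- **`rank E_{−2qp}(ℚ) ≤ 1`, and `rank = 1 ⇒ Ш(E_{−2qp}/ℚ)[2] = 0`** (UNCONDITIONAL, no Cassels–Tate) for the two-torsion model
`E_{−2qp} : y² = x³ − 42qp·x² + 448q²p²·x` on a35+ (`q ≡ 3 (8)`, `(q/7) = −1`, `p ≡ 5 (8)`, `(−7/p) = 1`, type α, `(p/q) = +1`; `#S · #S′ ≤ 2·4 = 8`).
[cite: SilvermanAEC2009, Thm. X.4.2(a), Prop. X.4.9] -/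
theorem rank_le_one_and_sha_two_twoTorsionModel_twoPrimesTwist_threeModEightPlusPFiveAlpha (hq8 : q % 8 = 3) (hq7 : jacobiSym q 7 = -1) (hp8 : p % 8 = 5)
    (hp7 : legendreSym p (-7) = 1) (hα : ¬ ∃ x : ZMod p, x ^ 4 = -7) (hpq : jacobiSym p q = 1)
    [hE : (⟨0, ((-42 * ((q : ℤ) * p) : ℤ) : ℚ), 0, ((448 * ((q : ℤ) * p) ^ 2 : ℤ) : ℚ), 0⟩ : WeierstrassCurve ℚ).IsElliptic] :
    (⟨0, ((-42 * ((q : ℤ) * p) : ℤ) : ℚ), 0, ((448 * ((q : ℤ) * p) ^ 2 : ℤ) : ℚ), 0⟩ : WeierstrassCurve ℚ).mordellWeilRank ≤ 1 ∧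
      ((⟨0, ((-42 * ((q : ℤ) * p) : ℤ) : ℚ), 0, ((448 * ((q : ℤ) * p) ^ 2 : ℤ) : ℚ), 0⟩ : WeierstrassCurve ℚ).mordellWeilRank = 1 →
        ∀ c ∈ (⟨0, ((-42 * ((q : ℤ) * p) : ℤ) : ℚ), 0, ((448 * ((q : ℤ) * p) ^ 2 : ℤ) : ℚ), 0⟩ : WeierstrassCurve ℚ).sha,
          2 • c = 0 → c = 0) := by
  have hq : q.Prime := Fact.out
  have hp : p.Prime := Fact.out
  have hab := hab_inertTwoTwist (m := q * p) (Nat.mul_pos hq.pos hp.pos)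
  push_cast at hab
  haveI := isElliptic_halfModel hab
  have hS := card_twoIsogenySelmerGroup_twoPrimesTwist_le_two_threeModEightPlusPFive hq8 hq7 hp8 hpq
  have hS' := card_twoIsogenySelmerGroup'_twoPrimesTwist_le_four_threeModEightPlusPFiveAlpha hq8 hq7 hp8 hp7 hα hpq
  obtain ⟨hr, hparts⟩ := rank_le_one_and_sha_parts_of_card_mul_le hab
    (by nlinarith [hS, hS', Nat.zero_le (twoIsogenySelmerGroup (-42 * ((q : ℤ) * p)) (448 * ((q : ℤ) * p) ^ 2)).card])
  refine ⟨hr, fun h => ?_⟩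
  obtain ⟨h₀, h₁⟩ := hparts h
  exact forall_mem_sha_two_smul_eq_zero_of_halfModel h₀ h₁

/-- **UNCONDITIONAL: `rank W(ℚ) ≤ 1`, and `rank W(ℚ) = 1 ⇒ Ш(W/ℚ)[2] = 0`, for every model `W` of `49a1^{(−2qp)}`** on a35+.
[cite: SilvermanAEC2009, Thm. X.4.2(a), Prop. X.4.9, Thm. III.6.2(a)] -/
theorem rank_le_one_and_sha_two_twoPrimesTwist_threeModEightPlusPFiveAlpha (hq8 : q % 8 = 3) (hq7 : jacobiSym q 7 = -1) (hp8 : p % 8 = 5)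
    (hp7 : legendreSym p (-7) = 1) (hα : ¬ ∃ x : ZMod p, x ^ 4 = -7) (hpq : jacobiSym p q = 1)
    (W : WeierstrassCurve ℚ) [W.IsElliptic] (C : VariableChange ℚ)
    (hC : C • W = cm7.quadraticTwist ((-2 * ((q : ℤ) * p) : ℤ) : ℚ)) :
    W.mordellWeilRank ≤ 1 ∧ (W.mordellWeilRank = 1 → ∀ c ∈ W.sha, 2 • c = 0 → c = 0) := by
  have hq : q.Prime := Fact.out
  have hp : p.Prime := Fact.out
  have hab := hab_inertTwoTwist (m := q * p) (Nat.mul_pos hq.pos hp.pos)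
  push_cast at hab
  haveI := isElliptic_mk_of_ne_zero (F := ℚ) hab
  have hE := (smul_eq_twoTorsionModel_of_smul_eq_quadraticTwist (-2 * ((q : ℤ) * p)) W C hC).trans
    (show (⟨0, ((21 * (-2 * ((q : ℤ) * p)) : ℤ) : ℚ), 0, ((112 * (-2 * ((q : ℤ) * p)) ^ 2 : ℤ) : ℚ), 0⟩ :
        WeierstrassCurve ℚ) = ⟨0, ((-42 * ((q : ℤ) * p) : ℤ) : ℚ), 0, ((448 * ((q : ℤ) * p) ^ 2 : ℤ) : ℚ), 0⟩ by
      ext <;> push_cast <;> ring)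
  exact rank_le_one_and_sha_two_of_smul_eq W _ _ hE
    (rank_le_one_and_sha_two_twoTorsionModel_twoPrimesTwist_threeModEightPlusPFiveAlpha hq8 hq7 hp8 hp7 hα hpq)

/-- **UNCONDITIONAL, in rank one: `Ш(W)[2^∞] = 0` and `corank_{ℤ₂} Sel_{2^∞}(W) = 1`** for every model `W` of `49a1^{(−2qp)}` on a35+ with
`rank W(ℚ) = 1` — the algebraic half of the formula axis WITHOUT Cassels–Tate. [cite: SilvermanAEC2009, Thm. X.4.2(a), Prop. X.4.9] -/
theorem sha_two_primary_eq_bot_twoPrimesTwist_threeModEightPlusPFiveAlpha (hq8 : q % 8 = 3) (hq7 : jacobiSym q 7 = -1) (hp8 : p % 8 = 5)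
    (hp7 : legendreSym p (-7) = 1) (hα : ¬ ∃ x : ZMod p, x ^ 4 = -7) (hpq : jacobiSym p q = 1)
    (W : WeierstrassCurve ℚ) [W.IsElliptic] (C : VariableChange ℚ)
    (hC : C • W = cm7.quadraticTwist ((-2 * ((q : ℤ) * p) : ℤ) : ℚ)) (hr : W.mordellWeilRank = 1) :
    (∀ c ∈ W.sha, 2 • c = 0 → c = 0) ∧ AddCommGroup.primaryComponent W.sha 2 = ⊥ ∧ W.selmerCorank 2 = 1 := by
  haveI : Fact (Nat.Prime 2) := ⟨Nat.prime_two⟩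
  have h2 := (rank_le_one_and_sha_two_twoPrimesTwist_threeModEightPlusPFiveAlpha hq8 hq7 hp8 hp7 hα hpq W C hC).2 hr
  refine ⟨h2, W.primaryComponent_sha_eq_bot_of_forall h2, ?_⟩
  rw [W.selmerCorank_eq_mordellWeilRank_add_holds 2, hr, W.shaCorank_eq_zero_of_forall 2 h2]

end DescentSharpThreeModEightPlusPFiveAlpha

end Summit.BirchSwinnertonDyer.BirchSwinnertonDyer.Theorems.GoldfeldGoodTwists

end
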